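import Summits.ResolutionOfSingularities.ResolutionOfSingularities.Theorems.PurelyInseparableDim4AtlasChildReadings
import HarnessLib

/-!
# Purely inseparable four-folds: the FORMAT INVARIANT of the readings of an atlas child, and their edges (brick S3 (c) v4, tranche 1,
# brick A3-format; cell `res-dim4-pi`)

[OURS · counted 0] (D-0157 DOOR 2; host item stmt-ResolutionOfSingularities-16155, helper). Nothing here proves resolution of
singularities in dimension ≥ 4 / characteristic `p`. Bookkeeping for the host step A3 (`res-dim4-typ-3/S3c-V4-ATLAS-MEMBERS-DESIGN.md` §9
(I2), `MemberDataAT` of DefsThree): if a reading `(s, S, X, D)` satisfies the format invariant (deferred indices in `D`, `D ∩ S = ∅`) and the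
entry `(j, b, S″)` has `j ∈ S ∩ S″`, `D ⊆ S″`, then the main reading and every extra reading `l ∈ S ∖ S″` of the child satisfy it again; and
they are `AEdge`-successors of the parent reading, so `BlockA` along `AEdge` and accessibility are inherited.

* `mainReading_format`, `extraReading_format`, `aedge_mainReading`, `aedge_extraReading`.
AI-produced formalisation, weaker than expert review. bears_on: LADDER-RESOLUTION:D157-DOOR2 (res-dim4-pi · S3 (c) v4 A3-format).
-/

set_option linter.dupNamespace false -- D-0017: single-problem summit path `Summit.<S>.<S>.…` by design

noncomputable section

open MvPolynomial Finset

namespace Summit.ResolutionOfSingularities.ResolutionOfSingularities.Theorems.PIDim4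

open Literature.AlgebraicGeometry.Resolution
open Literature.AlgebraicGeometry.Resolution.Hauser2010

namespace Equimultiple

section ChildFormat

variable {K : Type} [Field K] (p : ℕ) [DecidableEq K]

/-- **The main reading keeps the format invariant**: its deferral set is empty and its bundle directions `S ∖ S″` miss its centre `S″`.
[folklore] -/
theorem mainReading_format (r : AReading K) (e : Fin 4 × (Fin 4 → K) × Finset (Fin 4))
    (hX : ∀ iv ∈ r.2.2.1, iv.1 ∈ r.2.2.2) (hD : r.2.2.2 ⊆ e.2.2) :
    (∀ iv ∈ (mainReading p r e).2.2.1, iv.1 ∈ (mainReading p r e).2.2.2) ∧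
      ∀ m ∈ (mainReading p r e).2.2.2, m ∉ (mainReading p r e).2.1 := by
  have h1 : (mainReading p r e).2.2.1 = ∅ := by
    change shiftDefer e.2.1 e.2.2 r.2.2.1 = ∅
    exact shiftDefer_eq_empty_of_indices hX hD e.2.1
  refine ⟨fun iv hiv => ?_, fun m hm => ?_⟩
  · rw [h1] at hiv; exact absurd hiv (Finset.notMem_empty iv)
  · change m ∈ r.2.1 \ e.2.2 at hm
    change m ∉ e.2.2
    exact (Finset.mem_sdiff.mp hm).2

/-- **An extra reading keeps the format invariant**: its deferral indices are `j` and the earlier extra charts, all among its bundle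
directions `(insert j (S ∖ S″)) ∖ {l}`, which miss its centre `insert l (S″ ∖ {j})`. [folklore] -/
theorem extraReading_format (r : AReading K) (e : Fin 4 × (Fin 4 → K) × Finset (Fin 4))
    (hX : ∀ iv ∈ r.2.2.1, iv.1 ∈ r.2.2.2) (hD : r.2.2.2 ⊆ e.2.2) (hDS : ∀ m ∈ r.2.2.2, m ∉ r.2.1)
    (hj : e.1 ∈ r.2.1) (hjS : e.1 ∈ e.2.2) {l : Fin 4} (hl : l ∈ r.2.1 \ e.2.2) :
    (∀ iv ∈ (extraReading p r e l).2.2.1, iv.1 ∈ (extraReading p r e l).2.2.2) ∧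
      ∀ m ∈ (extraReading p r e l).2.2.2, m ∉ (extraReading p r e l).2.1 := by
  obtain ⟨hlS, hlS''⟩ := Finset.mem_sdiff.mp hl
  have hlj : l ≠ e.1 := fun h => hlS'' (h ▸ hjS)
  have h1 : shiftDefer e.2.1 (insert l (e.2.2.erase e.1)) r.2.2.1 = ∅ := by
    refine shiftDefer_eq_empty_of_indices hX (fun m hm => ?_) e.2.1
    have hmj : m ≠ e.1 := fun h => hDS m hm (h ▸ hj)
    exact Finset.mem_insert_of_mem (Finset.mem_erase.mpr ⟨hmj, hD hm⟩)
  refine ⟨fun iv hiv => ?_, fun m hm => ?_⟩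
  · change iv ∈ shiftDefer e.2.1 (insert l (e.2.2.erase e.1)) r.2.2.1 ∪
      insert (e.1, (0 : K)) (((r.2.1 \ e.2.2).filter fun l' => l' < l).image fun l' => (l', (0 : K))) at hiv
    change iv.1 ∈ (insert e.1 (r.2.1 \ e.2.2)).erase l
    rw [h1, Finset.empty_union, Finset.mem_insert, Finset.mem_image] at hiv
    rcases hiv with rfl | ⟨l', hl', rfl⟩
    · exact Finset.mem_erase.mpr ⟨Ne.symm hlj, Finset.mem_insert_self _ _⟩
    · obtain ⟨hl'S, hlt⟩ := Finset.mem_filter.mp hl'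
      exact Finset.mem_erase.mpr ⟨ne_of_lt hlt, Finset.mem_insert_of_mem hl'S⟩
  · change m ∈ (insert e.1 (r.2.1 \ e.2.2)).erase l at hm
    change m ∉ insert l (e.2.2.erase e.1)
    obtain ⟨hml, hm⟩ := Finset.mem_erase.mp hm
    rw [Finset.mem_insert, not_or]
    refine ⟨hml, fun h => ?_⟩
    obtain ⟨hmj, hmS''⟩ := Finset.mem_erase.mp h
    rcases Finset.mem_insert.mp hm with h' | h'
    · exact hmj h'
    · exact (Finset.mem_sdiff.mp h').2 hmS''

/-- The main reading is an `AEdge`-successor of the parent reading. [folklore] -/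
theorem aedge_mainReading (plan : AReading K → Finset (Fin 4 × (Fin 4 → K) × Finset (Fin 4))) (r : AReading K)
    {e : Fin 4 × (Fin 4 → K) × Finset (Fin 4)} (he : e ∈ plan r) : AEdge p plan (mainReading p r e) r :=
  ⟨e, he, Or.inl rfl⟩

/-- An extra reading is an `AEdge`-successor of the parent reading. [folklore] -/
theorem aedge_extraReading (plan : AReading K → Finset (Fin 4 × (Fin 4 → K) × Finset (Fin 4))) (r : AReading K)
    {e : Fin 4 × (Fin 4 → K) × Finset (Fin 4)} (he : e ∈ plan r) {l : Fin 4} (hl : l ∈ r.2.1 \ e.2.2) :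
    AEdge p plan (extraReading p r e l) r :=
  ⟨e, he, Or.inr ⟨l, hl, rfl⟩⟩

end ChildFormat

end Equimultiple

end Summit.ResolutionOfSingularities.ResolutionOfSingularities.Theorems.PIDim4

end
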